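import Mathlib
import HarnessLib
import Summits.HubbardSuperconductivity.HubbardSuperconductivity.Theorems.KLProgrammeC4aUmkCurrencyIdentity

/-!
# Route `KLProgramme` — crux C4a, S3 brick (B4) «(U1)-HYBRID» B-1 (vii): THE FIRST-ORDER CO-MOVING JET OF ONE LEVEL LINE IN THE ABSOLUTE CURRENCY —
# `∂_θ ∫_{(−π,π)} J(e,φ+θ)·Ψ(ē) dφ = ∫_{−π}^{π} J(e,v+θ)·G(ϑ,e,v)·Ψ′(ē) dv`, and for a real kernel its norm is `|∫ J·G·K′(ē)|`

Cell `gate-hubbard-kl`, seat hubbard-kl-k3c3-p3 (g37; row «implicit-function / monotonicity route for μ(n)»).  Located brick for the (C)-closer lane / the `M₁`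
assembly (stub (C) `stub_twoLeg_curvature` of `KLRegimeEngineV17F2`, stmt-HubbardSuperconductivity-20437), memo HOME/hubbard-kl-k3c3-p3/U1-CAUSTIC-SUP.md §19–§20
(B-1): the bridge between (B3) (`…C4aBubbleTubeDeriv.hasDerivAt_loopIntegral_pp`: `∂_θ I(e;θ) = ∫[J·𝒜·Ψ′(ē) + ∂_sJ·Ψ(ē)]`, co-moving currency) and the currency of
`…C4aFirstOrderLayerSum.firstOrderLayer_abs_le` (numerator `J·G`, `G = De_K(S − Φ(e,v+θ))[S′]`).

WHY.  Pointwise `𝒜 = G + ∂_vē` (`…C4aUmkCurrencyIdentity.geomFactor_eq_anisotropy_sub_slope`), so `J·𝒜·Ψ′(ē) + ∂_sJ·Ψ(ē) = J·G·Ψ′(ē) + ∂_v[J(e,v+θ)·Ψ(ē(v))]`, and the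
total derivative of a `2π`-periodic `C¹` function integrates to zero over the loop circle.
* `intervalIntegral_deriv_jacPsi_eq_zero` — `∫_{−π}^{π} ∂_v[J(e,v+θ)·Ψ(ē)] dv = 0`;
* **`loopIntegral_firstOrder_eq`** — the identity of the two first-order integrands under the loop integral;
* **`hasDerivAt_loopIntegral_pp_abs`** — `∂_θ I(e;θ) = ∫_{−π}^{π} (J(e,v+θ)·G)·Ψ′(ē) dv` (smooth bounded `Ψ : ℝ → ℂ` with bounded derivative);
* **`norm_deriv_loopIntegral_pp_eq_abs`** — for a real `C²` kernel `K` (bounded, bounded derivative), `Ψ = (K : ℝ → ℂ)`: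
  `‖∂_θ I(e;θ)‖ = |∫_{−π}^{π} J(e,v+θ)·G·K′(ē) dv|` — the level line of `firstOrderLayer_abs_le` with `Jw e v = J(e,v+θ)`.
Sizes binder shape; pure calculus on landed objects; nothing asserts (C), K3 or superconductivity.
References: FST II CPAM 51 (1998) §3 [cite: FeldmanSalmhoferTrubowitz1998]; BGM 2006 §2.4 (2.40) [cite: BenfattoGiulianiMastropietro2006].
-/

noncomputable section

namespace Summit.HubbardSuperconductivity.HubbardSuperconductivity.Theorems.C4a

set_option linter.dupNamespace false -- summit = problem name (single-conjunct summit), D-0017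

open Real Set Filter MeasureTheory intervalIntegral
open scoped Topology ContDiff
open Literature.MathematicalPhysics.QuantumLattice Literature.MathematicalPhysics.QuantumLattice.BandSectorCounting Literature.Probability.LatticeModels
open Summit.HubbardSuperconductivity.HubbardSuperconductivity.Theorems.KLRegimeSplit
open Summit.HubbardSuperconductivity.HubbardSuperconductivity.Theorems.DispersionFlow
open Summit.HubbardSuperconductivity.HubbardSuperconductivity.Theorems.PerturbedFermiCurve

section Sizes

variable {K : TrigPolyC4v} {A : ℝ} (hA : ∀ p : Momentum, ∀ j ≤ 2, ‖iteratedFDeriv ℝ j (frameShift K) p‖ ≤ A) (hA20 : A ≤ 1 / 20)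
  (hd : klCurveD ≤ (bandBounds (show (-4 : ℝ) < -1.1 by norm_num) (show (-1.1 : ℝ) ≤ -0.1 by norm_num)
    (show (-0.1 : ℝ) < 0 by norm_num)).Dtmin - 2 * A)
  {μ r : ℝ} (hr : 0 < r) (hlo : (-1.1 : ℝ) < μ - r - A) (hhi : μ + r + A < -0.1)
  {A₃ A₄ : ℝ} (hA₃ : ∀ p : Momentum, ‖iteratedFDeriv ℝ 3 (frameShift K) p‖ ≤ A₃)
  (hA₄ : ∀ p : Momentum, ‖iteratedFDeriv ℝ 4 (frameShift K) p‖ ≤ A₄)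
  {K₁ : ℝ} (hK₁ : ∀ p : Momentum, ‖fderiv ℝ (frameLevel μ K) p‖ ≤ K₁)
include hA hA20 hd hr hlo hhi hA₃ hA₄ hK₁

omit hA20 hr hA₃ hA₄ hK₁ in
/-- **The total loop-angle derivative of `J(e,v+θ)·Ψ(ē(v))` integrates to zero over the loop circle** (`Ψ ∈ C¹`, `|e| < r`). -/
theorem intervalIntegral_deriv_jacPsi_eq_zero {Ψ : ℝ → ℂ} (hΨ : ContDiff ℝ 1 Ψ) {ρ e : ℝ} (he : |e| < r) (ϑ θ : ℝ) :
    ∫ v in (-π)..π, ((deriv (fun s : ℝ => levelChartJac μ K (e, s)) (v + θ)) •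
        Ψ (frameLevel μ K (pairSumPath μ K ρ ϑ θ 0 - levelPoint μ K e (v + θ))) +
      (levelChartJac μ K (e, v + θ) : ℝ) •
        ((deriv (fun x : ℝ => frameLevel μ K (pairSumPath μ K ρ ϑ θ 0 - levelPoint μ K e (x + θ))) v) •
          deriv Ψ (frameLevel μ K (pairSumPath μ K ρ ϑ θ 0 - levelPoint μ K e (v + θ))))) = 0 := by
  set B₀ := bandBounds (show (-4 : ℝ) < -1.1 by norm_num) (show (-1.1 : ℝ) ≤ -0.1 by norm_num) (show (-0.1 : ℝ) < 0 by norm_num) with hB₀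
  have hADt : 2 * A < B₀.Dtmin := by have := klCurveD_pos; linarith only [this, hd]
  set g : ℝ → ℝ := fun x => frameLevel μ K (pairSumPath μ K ρ ϑ θ 0 - levelPoint μ K e (x + θ)) with hg
  have hgC : ContDiff ℝ 1 g := contDiff_partnerBand_pp_angle hA hd hlo hhi ρ he ϑ θ 1
  have hgd : ∀ x, HasDerivAt g (deriv g x) x := fun x => ((hgC.differentiable (by norm_num)) x).hasDerivAt
  have hJC : ContDiff ℝ ∞ (fun s : ℝ => levelChartJac μ K (e, s)) := contDiff_levelChartJac_angle B₀ hA hADt hlo hhi he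
  have hJd : ∀ v, HasDerivAt (fun v : ℝ => levelChartJac μ K (e, v + θ)) (deriv (fun s : ℝ => levelChartJac μ K (e, s)) (v + θ)) v := fun v =>
    HasDerivAt.comp_add_const v θ (((hJC.differentiable (by simp)) (v + θ)).hasDerivAt)
  have hΨd : ∀ x, HasDerivAt Ψ (deriv Ψ x) x := fun x => ((hΨ.differentiable (by norm_num)) x).hasDerivAt
  -- the product `F v = J(e,v+θ) • Ψ(g v)` and its derivative
  have hF : ∀ v, HasDerivAt (fun v : ℝ => (levelChartJac μ K (e, v + θ) : ℝ) • Ψ (g v))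
      ((levelChartJac μ K (e, v + θ) : ℝ) • (deriv g v • deriv Ψ (g v)) + (deriv (fun s : ℝ => levelChartJac μ K (e, s)) (v + θ)) • Ψ (g v)) v := by
    intro v
    have hcomp : HasDerivAt (fun v => Ψ (g v)) (deriv g v • deriv Ψ (g v)) v := (hΨd (g v)).scomp v (hgd v)
    exact (hJd v).smul hcomp
  have hcont : Continuous fun v : ℝ => (levelChartJac μ K (e, v + θ) : ℝ) • (deriv g v • deriv Ψ (g v)) +
      (deriv (fun s : ℝ => levelChartJac μ K (e, s)) (v + θ)) • Ψ (g v) := by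
    have h1 : Continuous fun v : ℝ => levelChartJac μ K (e, v + θ) := hJC.continuous.comp (continuous_id.add continuous_const)
    have h2 : Continuous fun v : ℝ => deriv (fun s : ℝ => levelChartJac μ K (e, s)) (v + θ) :=
      (hJC.continuous_deriv (by simp)).comp (continuous_id.add continuous_const)
    have h3 : Continuous fun v => deriv g v := hgC.continuous_deriv le_rfl
    have h4 : Continuous fun v => deriv Ψ (g v) := (hΨ.continuous_deriv le_rfl).comp hgC.continuous
    have h5 : Continuous fun v => Ψ (g v) := hΨ.continuous.comp hgC.continuous
    exact (h1.smul (h3.smul h4)).add (h2.smul h5)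
  have hftc := intervalIntegral.integral_eq_sub_of_hasDerivAt (a := -π) (b := π) (fun v _ => hF v) (hcont.intervalIntegrable _ _)
  -- periodic boundary values
  have hper : (levelChartJac μ K (e, π + θ) : ℝ) • Ψ (g π) = (levelChartJac μ K (e, -π + θ) : ℝ) • Ψ (g (-π)) := by
    have hJ : levelChartJac μ K (e, -π + θ + 2 * π) = levelChartJac μ K (e, -π + θ) := levelChartJac_periodic μ K e (-π + θ)
    have hgp : g π = g (-π) := by
      simp only [hg]; rw [show π + θ = (-π + θ) + 2 * π by ring, levelPoint_add_two_pi]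
    rw [show π + θ = -π + θ + 2 * π by ring, hJ, hgp]
  rw [hper, sub_self] at hftc
  rw [← hftc]
  refine intervalIntegral.integral_congr fun v _ => ?_
  simp only [hg]; rw [add_comm]

omit hA20 hr hA₃ hA₄ hK₁ in
/-- **THE TWO FIRST-ORDER INTEGRANDS AGREE UNDER THE LOOP INTEGRAL**: with `𝒜 = De_K(P)[S′ − ∂_sΦ(e,φ+θ)]`, `G = De_K(P)[S′]`, `P = S − Φ(e,φ+θ)`:
`∫_{(−π,π)} [J·(𝒜·Ψ′(ē)) + ∂_sJ·Ψ(ē)] dφ = ∫_{−π}^{π} (J·G)·Ψ′(ē) dv` (`Ψ ∈ C¹`, `|e| < r`). -/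
theorem loopIntegral_firstOrder_eq {Ψ : ℝ → ℂ} (hΨ : ContDiff ℝ 1 Ψ) (ρ : ℝ) {e : ℝ} (he : |e| < r) (ϑ θ : ℝ) :
    (∫ φ in Ioo (-π) π,
        ((levelChartJac μ K (e, φ + θ) : ℝ) •
            ((fderiv ℝ (frameLevel μ K) (levelPoint μ K 0 θ + levelPoint μ K ρ (ϑ + θ) - levelPoint μ K e (φ + θ))
                (iteratedDeriv 1 (levelPoint μ K 0) θ + iteratedDeriv 1 (levelPoint μ K ρ) (ϑ + θ) - iteratedDeriv 1 (levelPoint μ K e) (φ + θ))) •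
              deriv Ψ (frameLevel μ K (levelPoint μ K 0 θ + levelPoint μ K ρ (ϑ + θ) - levelPoint μ K e (φ + θ)))) +
          (deriv (fun s : ℝ => levelChartJac μ K (e, s)) (φ + θ)) •
            Ψ (frameLevel μ K (levelPoint μ K 0 θ + levelPoint μ K ρ (ϑ + θ) - levelPoint μ K e (φ + θ))))) =
      ∫ v in (-π)..π, (levelChartJac μ K (e, v + θ) *
          (fderiv ℝ (frameLevel μ K) (pairSumPath μ K ρ ϑ θ 0 - levelPoint μ K e (v + θ)))
            (iteratedDeriv 1 (levelPoint μ K 0) θ + iteratedDeriv 1 (levelPoint μ K ρ) (ϑ + θ))) •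
        deriv Ψ (frameLevel μ K (pairSumPath μ K ρ ϑ θ 0 - levelPoint μ K e (v + θ))) := by
  have hππ : -π ≤ π := by linarith [Real.pi_pos]
  have hS : ∀ φ, levelPoint μ K 0 θ + levelPoint μ K ρ (ϑ + θ) - levelPoint μ K e (φ + θ) = pairSumPath μ K ρ ϑ θ 0 - levelPoint μ K e (φ + θ) := fun φ => by
    simp only [pairSumPath, add_zero]
  -- the slope of the partner band
  have hslope : ∀ v, deriv (fun x : ℝ => frameLevel μ K (pairSumPath μ K ρ ϑ θ 0 - levelPoint μ K e (x + θ))) v =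
      -fderiv ℝ (frameLevel μ K) (pairSumPath μ K ρ ϑ θ 0 - levelPoint μ K e (v + θ)) (iteratedDeriv 1 (levelPoint μ K e) (v + θ)) := fun v =>
    (hasDerivAt_partnerBand_pp_angle hA hd hlo hhi (ρ := ρ) he ϑ θ v).deriv
  -- pointwise split of the integrand
  have hpt : ∀ φ, ((levelChartJac μ K (e, φ + θ) : ℝ) •
            ((fderiv ℝ (frameLevel μ K) (levelPoint μ K 0 θ + levelPoint μ K ρ (ϑ + θ) - levelPoint μ K e (φ + θ))
                (iteratedDeriv 1 (levelPoint μ K 0) θ + iteratedDeriv 1 (levelPoint μ K ρ) (ϑ + θ) - iteratedDeriv 1 (levelPoint μ K e) (φ + θ))) •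
              deriv Ψ (frameLevel μ K (levelPoint μ K 0 θ + levelPoint μ K ρ (ϑ + θ) - levelPoint μ K e (φ + θ)))) +
          (deriv (fun s : ℝ => levelChartJac μ K (e, s)) (φ + θ)) •
            Ψ (frameLevel μ K (levelPoint μ K 0 θ + levelPoint μ K ρ (ϑ + θ) - levelPoint μ K e (φ + θ)))) =
      (levelChartJac μ K (e, φ + θ) *
          (fderiv ℝ (frameLevel μ K) (pairSumPath μ K ρ ϑ θ 0 - levelPoint μ K e (φ + θ)))
            (iteratedDeriv 1 (levelPoint μ K 0) θ + iteratedDeriv 1 (levelPoint μ K ρ) (ϑ + θ))) •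
        deriv Ψ (frameLevel μ K (pairSumPath μ K ρ ϑ θ 0 - levelPoint μ K e (φ + θ))) +
      ((deriv (fun s : ℝ => levelChartJac μ K (e, s)) (φ + θ)) •
        Ψ (frameLevel μ K (pairSumPath μ K ρ ϑ θ 0 - levelPoint μ K e (φ + θ))) +
      (levelChartJac μ K (e, φ + θ) : ℝ) •
        ((deriv (fun x : ℝ => frameLevel μ K (pairSumPath μ K ρ ϑ θ 0 - levelPoint μ K e (x + θ))) φ) •
          deriv Ψ (frameLevel μ K (pairSumPath μ K ρ ϑ θ 0 - levelPoint μ K e (φ + θ))))) := by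
    intro φ
    rw [hS φ, hslope φ, map_sub]
    simp only [sub_smul, smul_sub, neg_smul, smul_neg, mul_smul]
    abel
  rw [← integral_Ioc_eq_integral_Ioo, ← intervalIntegral.integral_of_le hππ, intervalIntegral.integral_congr (fun φ _ => hpt φ)]
  -- integrability of the two parts (continuity)
  set B₀ := bandBounds (show (-4 : ℝ) < -1.1 by norm_num) (show (-1.1 : ℝ) ≤ -0.1 by norm_num) (show (-0.1 : ℝ) < 0 by norm_num) with hB₀
  have hADt : 2 * A < B₀.Dtmin := by have := klCurveD_pos; linarith only [this, hd]
  have hgC : ContDiff ℝ 1 (fun x : ℝ => frameLevel μ K (pairSumPath μ K ρ ϑ θ 0 - levelPoint μ K e (x + θ))) :=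
    contDiff_partnerBand_pp_angle hA hd hlo hhi ρ he ϑ θ 1
  have hJC : ContDiff ℝ ∞ (fun s : ℝ => levelChartJac μ K (e, s)) := contDiff_levelChartJac_angle B₀ hA hADt hlo hhi he
  have h1 : Continuous fun v : ℝ => levelChartJac μ K (e, v + θ) := hJC.continuous.comp (continuous_id.add continuous_const)
  have h2 : Continuous fun v : ℝ => deriv (fun s : ℝ => levelChartJac μ K (e, s)) (v + θ) :=
    (hJC.continuous_deriv (by simp)).comp (continuous_id.add continuous_const)
  have h4 : Continuous fun v => deriv Ψ (frameLevel μ K (pairSumPath μ K ρ ϑ θ 0 - levelPoint μ K e (v + θ))) :=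
    (hΨ.continuous_deriv le_rfl).comp hgC.continuous
  have h5 : Continuous fun v => Ψ (frameLevel μ K (pairSumPath μ K ρ ϑ θ 0 - levelPoint μ K e (v + θ))) := hΨ.continuous.comp hgC.continuous
  have hG : Continuous fun v : ℝ => (fderiv ℝ (frameLevel μ K) (pairSumPath μ K ρ ϑ θ 0 - levelPoint μ K e (v + θ)))
      (iteratedDeriv 1 (levelPoint μ K 0) θ + iteratedDeriv 1 (levelPoint μ K ρ) (ϑ + θ)) := by
    have hfe : Continuous (fderiv ℝ (frameLevel μ K)) := (EngineV8.contDiff_frameLevel μ K (n := 1)).continuous_fderiv one_ne_zero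
    have hP : Continuous fun v : ℝ => pairSumPath μ K ρ ϑ θ 0 - levelPoint μ K e (v + θ) :=
      continuous_const.sub ((contDiff_levelPoint_of_sizes hA hd hlo hhi he 0).continuous.comp (continuous_id.add continuous_const))
    exact (hfe.comp hP).clm_apply continuous_const
  have hiA : IntervalIntegrable (fun v => (levelChartJac μ K (e, v + θ) *
          (fderiv ℝ (frameLevel μ K) (pairSumPath μ K ρ ϑ θ 0 - levelPoint μ K e (v + θ)))
            (iteratedDeriv 1 (levelPoint μ K 0) θ + iteratedDeriv 1 (levelPoint μ K ρ) (ϑ + θ))) •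
        deriv Ψ (frameLevel μ K (pairSumPath μ K ρ ϑ θ 0 - levelPoint μ K e (v + θ)))) volume (-π) π :=
    ((h1.mul hG).smul h4).intervalIntegrable _ _
  have hiB : IntervalIntegrable (fun v => (deriv (fun s : ℝ => levelChartJac μ K (e, s)) (v + θ)) •
        Ψ (frameLevel μ K (pairSumPath μ K ρ ϑ θ 0 - levelPoint μ K e (v + θ))) +
      (levelChartJac μ K (e, v + θ) : ℝ) •
        ((deriv (fun x : ℝ => frameLevel μ K (pairSumPath μ K ρ ϑ θ 0 - levelPoint μ K e (x + θ))) v) •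
          deriv Ψ (frameLevel μ K (pairSumPath μ K ρ ϑ θ 0 - levelPoint μ K e (v + θ))))) volume (-π) π :=
    ((h2.smul h5).add (h1.smul ((hgC.continuous_deriv le_rfl).smul h4))).intervalIntegrable _ _
  rw [intervalIntegral.integral_add hiA hiB, intervalIntegral_deriv_jacPsi_eq_zero hA hd hlo hhi hΨ he ϑ θ, add_zero]

/-- **THE FIRST-ORDER CO-MOVING JET OF ONE LEVEL LINE, ABSOLUTE CURRENCY**: for a `C²` `Ψ : ℝ → ℂ` with `‖Ψ‖ ≤ M₀`, `‖Ψ′‖ ≤ M₁`, `|e|, |ρ| < r`,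
`θ ↦ ∫_{(−π,π)} J(e,φ+θ)·Ψ(ē) dφ` has derivative `∫_{−π}^{π} (J(e,v+θ₀)·G)·Ψ′(ē) dv` at `θ₀`. [cite: BenfattoGiulianiMastropietro2006, §2.4 (2.40)] -/
theorem hasDerivAt_loopIntegral_pp_abs {Ψ : ℝ → ℂ} (hΨ : ContDiff ℝ 2 Ψ) {M₀ M₁ : ℝ} (hΨ0 : ∀ x, ‖Ψ x‖ ≤ M₀) (hΨ1 : ∀ x, ‖deriv Ψ x‖ ≤ M₁)
    {ρ e : ℝ} (hρ : |ρ| < r) (he : |e| < r) (ϑ θ₀ : ℝ) :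
    HasDerivAt (fun θ : ℝ => ∫ φ in Ioo (-π) π,
        (levelChartJac μ K (e, φ + θ) : ℝ) • Ψ (frameLevel μ K (levelPoint μ K 0 θ + levelPoint μ K ρ (ϑ + θ) - levelPoint μ K e (φ + θ))))
      (∫ v in (-π)..π, (levelChartJac μ K (e, v + θ₀) *
          (fderiv ℝ (frameLevel μ K) (pairSumPath μ K ρ ϑ θ₀ 0 - levelPoint μ K e (v + θ₀)))
            (iteratedDeriv 1 (levelPoint μ K 0) θ₀ + iteratedDeriv 1 (levelPoint μ K ρ) (ϑ + θ₀))) •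
        deriv Ψ (frameLevel μ K (pairSumPath μ K ρ ϑ θ₀ 0 - levelPoint μ K e (v + θ₀)))) θ₀ := by
  have h := hasDerivAt_loopIntegral_pp hA hA20 hd hr hlo hhi hA₃ hA₄ hK₁ hΨ hΨ0 hΨ1 hρ he ϑ θ₀
  rw [loopIntegral_firstOrder_eq hA hd hlo hhi (hΨ.of_le (by norm_num)) ρ he ϑ θ₀] at h
  exact h

/-- **REAL KERNELS: THE NORM OF THE FIRST-ORDER JET IS THE LEVEL LINE OF `firstOrderLayer_abs_le`**: for a real `C²` kernel `K` with `|K| ≤ M₀`, `|K′| ≤ M₁` and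
`Ψ = (K : ℝ → ℂ)`:  `‖∂_θ ∫_{(−π,π)} J(e,φ+θ)·Ψ(ē) dφ‖ = |∫_{−π}^{π} J(e,v+θ₀)·G·K′(ē) dv|`. -/
theorem norm_deriv_loopIntegral_pp_eq_abs {Kr : ℝ → ℝ} (hK : ContDiff ℝ 2 Kr) {M₀ M₁ : ℝ} (hK0 : ∀ x, |Kr x| ≤ M₀) (hK1 : ∀ x, |deriv Kr x| ≤ M₁)
    {ρ e : ℝ} (hρ : |ρ| < r) (he : |e| < r) (ϑ θ₀ : ℝ) :
    ‖deriv (fun θ : ℝ => ∫ φ in Ioo (-π) π,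
        (levelChartJac μ K (e, φ + θ) : ℝ) • ((Kr (frameLevel μ K (levelPoint μ K 0 θ + levelPoint μ K ρ (ϑ + θ) - levelPoint μ K e (φ + θ))) : ℝ) : ℂ)) θ₀‖ =
      |∫ v in (-π)..π, levelChartJac μ K (e, v + θ₀) *
          (fderiv ℝ (frameLevel μ K) (pairSumPath μ K ρ ϑ θ₀ 0 - levelPoint μ K e (v + θ₀)))
            (iteratedDeriv 1 (levelPoint μ K 0) θ₀ + iteratedDeriv 1 (levelPoint μ K ρ) (ϑ + θ₀)) *
        deriv Kr (frameLevel μ K (pairSumPath μ K ρ ϑ θ₀ 0 - levelPoint μ K e (v + θ₀)))| := by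
  set Ψ : ℝ → ℂ := fun u => ((Kr u : ℝ) : ℂ) with hΨdef
  have hΨ : ContDiff ℝ 2 Ψ := Complex.ofRealCLM.contDiff.comp hK
  have hΨ' : ∀ u, deriv Ψ u = ((deriv Kr u : ℝ) : ℂ) := fun u => by
    have h := ((hK.differentiable (by norm_num)) u).hasDerivAt.ofReal_comp
    exact h.deriv
  have hΨ0 : ∀ x, ‖Ψ x‖ ≤ M₀ := fun x => by simp only [hΨdef, Complex.norm_real, Real.norm_eq_abs]; exact hK0 x
  have hΨ1 : ∀ x, ‖deriv Ψ x‖ ≤ M₁ := fun x => by rw [hΨ' x, Complex.norm_real, Real.norm_eq_abs]; exact hK1 x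
  have h := hasDerivAt_loopIntegral_pp_abs hA hA20 hd hr hlo hhi hA₃ hA₄ hK₁ hΨ hΨ0 hΨ1 hρ he ϑ θ₀
  rw [h.deriv]
  have hint : (∫ v in (-π)..π, (levelChartJac μ K (e, v + θ₀) *
          (fderiv ℝ (frameLevel μ K) (pairSumPath μ K ρ ϑ θ₀ 0 - levelPoint μ K e (v + θ₀)))
            (iteratedDeriv 1 (levelPoint μ K 0) θ₀ + iteratedDeriv 1 (levelPoint μ K ρ) (ϑ + θ₀))) •
        deriv Ψ (frameLevel μ K (pairSumPath μ K ρ ϑ θ₀ 0 - levelPoint μ K e (v + θ₀)))) =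
      (((∫ v in (-π)..π, levelChartJac μ K (e, v + θ₀) *
          (fderiv ℝ (frameLevel μ K) (pairSumPath μ K ρ ϑ θ₀ 0 - levelPoint μ K e (v + θ₀)))
            (iteratedDeriv 1 (levelPoint μ K 0) θ₀ + iteratedDeriv 1 (levelPoint μ K ρ) (ϑ + θ₀)) *
        deriv Kr (frameLevel μ K (pairSumPath μ K ρ ϑ θ₀ 0 - levelPoint μ K e (v + θ₀))) : ℝ) : ℂ)) := by
    rw [← intervalIntegral.integral_ofReal]
    refine intervalIntegral.integral_congr fun v _ => ?_
    simp only [hΨ', Complex.real_smul, Complex.ofReal_mul]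
  rw [hint, Complex.norm_real, Real.norm_eq_abs]

/-- **COMPLEX KERNELS: the norm of the first-order jet of one level line is at most the sum of the REAL and IMAGINARY level lines** of
`firstOrderLayer_abs_le` (kernels `u ↦ re Ψ u`, `u ↦ im Ψ u`): for a `C²` `Ψ : ℝ → ℂ` with `‖Ψ‖ ≤ M₀`, `‖Ψ′‖ ≤ M₁`, `|e|, |ρ| < r`,
`‖∂_θ ∫_{(−π,π)} J•Ψ(ē)‖ ≤ |∫_{−π}^{π} J·G·(re Ψ)′(ē)| + |∫_{−π}^{π} J·G·(im Ψ)′(ē)|`. -/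
theorem norm_deriv_loopIntegral_pp_le_re_add_im {Ψ : ℝ → ℂ} (hΨ : ContDiff ℝ 2 Ψ) {M₀ M₁ : ℝ} (hΨ0 : ∀ x, ‖Ψ x‖ ≤ M₀) (hΨ1 : ∀ x, ‖deriv Ψ x‖ ≤ M₁)
    {ρ e : ℝ} (hρ : |ρ| < r) (he : |e| < r) (ϑ θ₀ : ℝ) :
    ‖deriv (fun θ : ℝ => ∫ φ in Ioo (-π) π,
        (levelChartJac μ K (e, φ + θ) : ℝ) • Ψ (frameLevel μ K (levelPoint μ K 0 θ + levelPoint μ K ρ (ϑ + θ) - levelPoint μ K e (φ + θ)))) θ₀‖ ≤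
      |∫ v in (-π)..π, levelChartJac μ K (e, v + θ₀) *
          (fderiv ℝ (frameLevel μ K) (pairSumPath μ K ρ ϑ θ₀ 0 - levelPoint μ K e (v + θ₀)))
            (iteratedDeriv 1 (levelPoint μ K 0) θ₀ + iteratedDeriv 1 (levelPoint μ K ρ) (ϑ + θ₀)) *
        deriv (fun u : ℝ => (Ψ u).re) (frameLevel μ K (pairSumPath μ K ρ ϑ θ₀ 0 - levelPoint μ K e (v + θ₀)))| +
      |∫ v in (-π)..π, levelChartJac μ K (e, v + θ₀) *
          (fderiv ℝ (frameLevel μ K) (pairSumPath μ K ρ ϑ θ₀ 0 - levelPoint μ K e (v + θ₀)))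
            (iteratedDeriv 1 (levelPoint μ K 0) θ₀ + iteratedDeriv 1 (levelPoint μ K ρ) (ϑ + θ₀)) *
        deriv (fun u : ℝ => (Ψ u).im) (frameLevel μ K (pairSumPath μ K ρ ϑ θ₀ 0 - levelPoint μ K e (v + θ₀)))| := by
  set B₀ := bandBounds (show (-4 : ℝ) < -1.1 by norm_num) (show (-1.1 : ℝ) ≤ -0.1 by norm_num) (show (-0.1 : ℝ) < 0 by norm_num) with hB₀
  have hADt : 2 * A < B₀.Dtmin := by have := klCurveD_pos; linarith only [this, hd]
  have h := hasDerivAt_loopIntegral_pp_abs hA hA20 hd hr hlo hhi hA₃ hA₄ hK₁ hΨ hΨ0 hΨ1 hρ he ϑ θ₀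
  rw [h.deriv]
  -- the real and imaginary parts of `Ψ′`
  have hΨd : ∀ u, HasDerivAt Ψ (deriv Ψ u) u := fun u => ((hΨ.differentiable (by norm_num)) u).hasDerivAt
  have hre : ∀ u, deriv (fun u : ℝ => (Ψ u).re) u = (deriv Ψ u).re := fun u =>
    (Complex.reCLM.hasFDerivAt.comp_hasDerivAt u (hΨd u)).deriv
  have him : ∀ u, deriv (fun u : ℝ => (Ψ u).im) u = (deriv Ψ u).im := fun u =>
    (Complex.imCLM.hasFDerivAt.comp_hasDerivAt u (hΨd u)).deriv
  set g : ℝ → ℝ := fun v => levelChartJac μ K (e, v + θ₀) *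
    (fderiv ℝ (frameLevel μ K) (pairSumPath μ K ρ ϑ θ₀ 0 - levelPoint μ K e (v + θ₀)))
      (iteratedDeriv 1 (levelPoint μ K 0) θ₀ + iteratedDeriv 1 (levelPoint μ K ρ) (ϑ + θ₀)) with hg
  set E : ℝ → ℝ := fun v => frameLevel μ K (pairSumPath μ K ρ ϑ θ₀ 0 - levelPoint μ K e (v + θ₀)) with hE
  -- integrability of the complex integrand (continuity)
  have hEC : ContDiff ℝ 1 E := contDiff_partnerBand_pp_angle hA hd hlo hhi ρ he ϑ θ₀ 1
  have hJC : ContDiff ℝ ∞ (fun s : ℝ => levelChartJac μ K (e, s)) := contDiff_levelChartJac_angle B₀ hA hADt hlo hhi he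
  have hgc : Continuous g := by
    have h1 : Continuous fun v : ℝ => levelChartJac μ K (e, v + θ₀) := hJC.continuous.comp (continuous_id.add continuous_const)
    have hfe : Continuous (fderiv ℝ (frameLevel μ K)) := (EngineV8.contDiff_frameLevel μ K (n := 1)).continuous_fderiv one_ne_zero
    have hP : Continuous fun v : ℝ => pairSumPath μ K ρ ϑ θ₀ 0 - levelPoint μ K e (v + θ₀) :=
      continuous_const.sub ((contDiff_levelPoint_of_sizes hA hd hlo hhi he 0).continuous.comp (continuous_id.add continuous_const))
    exact h1.mul ((hfe.comp hP).clm_apply continuous_const)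
  have hI : IntervalIntegrable (fun v => (g v : ℝ) • deriv Ψ (E v)) volume (-π) π :=
    ((hgc.smul ((hΨ.continuous_deriv (by norm_num)).comp hEC.continuous))).intervalIntegrable _ _
  -- real and imaginary parts of the integral
  have hreI : (∫ v in (-π)..π, (g v : ℝ) • deriv Ψ (E v)).re = ∫ v in (-π)..π, g v * deriv (fun u : ℝ => (Ψ u).re) (E v) := by
    rw [← RCLike.re_eq_complex_re, ← intervalIntegral_re hI]
    refine intervalIntegral.integral_congr fun v _ => ?_
    simp only [hre, RCLike.re_eq_complex_re, Complex.real_smul, Complex.mul_re, Complex.ofReal_re, Complex.ofReal_im, zero_mul, sub_zero]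
  have himI : (∫ v in (-π)..π, (g v : ℝ) • deriv Ψ (E v)).im = ∫ v in (-π)..π, g v * deriv (fun u : ℝ => (Ψ u).im) (E v) := by
    rw [← RCLike.im_eq_complex_im, ← intervalIntegral_im hI]
    refine intervalIntegral.integral_congr fun v _ => ?_
    simp only [him, RCLike.im_eq_complex_im, Complex.real_smul, Complex.mul_im, Complex.ofReal_re, Complex.ofReal_im, zero_mul, add_zero]
  calc ‖∫ v in (-π)..π, (g v : ℝ) • deriv Ψ (E v)‖
      ≤ |(∫ v in (-π)..π, (g v : ℝ) • deriv Ψ (E v)).re| + |(∫ v in (-π)..π, (g v : ℝ) • deriv Ψ (E v)).im| := Complex.norm_le_abs_re_add_abs_im _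
    _ = _ := by rw [hreI, himI]

end Sizes

end Summit.HubbardSuperconductivity.HubbardSuperconductivity.Theorems.C4a

end
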